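import Literature.IUT.HodgeTheaters.GenuineFKitOfBadLocalTemperedArith

/-!
# Kernel DAG index — layer X = MIXED delta (L5 ×2; one file per cycle under the live-queue discipline); 2 DISCHARGE SIBLINGS `N_<id>'` — rule DSIB-1 (abc-iut-dag GO 2026-08-27T19:22:42Z, guards (a)–(g)): for a DATA node of a claim-kind row marked discharged(p…) the sibling binds, BY NAME, the theorems of the lead-designated proof module(s) — the p-id(s) of that token — whose CONCLUSION HEAD is the node's typed statement def (farm scan, ProducersScan conclusion-head rule; FACT-minimal choice per def: assumption-free dischargers preferred, others enter only when none exists and then their F-ids are named; conjuncts without discharger are listed and NOT claimed). A conclusion-head match is a kernel fact about the TYPED statement; whether a discharger discharges the PRINTED item is the referees' and leads' word (RQ7/REF passes, NODES.md), not this file's. Append-only: the data node stays; dag re-keys col 21 to the primed name, part zi (GENERATED by abc-iut-c312-2 gen 11 `work/gen_index.py` @2026-08-29T00:26Z from HOME/plan/DAG.tsv +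
KERNEL-DAG-MODULES.tsv (regenerated 2026-08-29T00:02:09Z): 2 landed/discharged nodes NOT YET in the tree index Summits/ABC/IUTFork/DAG*.lean; spec v1.3 §2 (M))

THIS FILE PROVES NOTHING NEW AND ASSERTS NOTHING (HOME/plan/KERNEL-DAG-SPEC.md). It gives ONE NAME `N_<kernel_id>` to each DAG node whose
statement has LANDED through the gate, knitting the landed declarations BY NAME: claim nodes `N_<id> : Prop := StatementOf @thm₁ ∧ …` (one
conjunct per landed theorem the DAG row names, universe levels instantiated explicitly per the spec's UNIVERSE RULE, arities read off the farm),
witnessed `N_<id>_holds` iff the DAG row is `discharged(p…)` and `N_<id>_part` otherwise (spec §2(b),(c); c312-2 F1/F2); data nodes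
`abbrev N_<id> := @<primary>` with the row's further declarations as `example := @…` lines; FACT-style `def … : Prop` declarations are data
here (a NAME, never asserted). Decl lists come from the `decls` column of plan/DAG.tsv as resolved against the tree sources (unresolvable
tokens dropped and reported to abc-iut-dag on STATUS). Nothing here says abc is proved or refuted or takes a side on [IUTchIII] Cor 3.12.
typed ≠ discharged; indexed ≠ endorsed.
-/

namespace Summit.ABC.IUTFork.DAG

namespace PartXzi
/-- `StatementOf h` is the statement (a `Prop`) of which the landed `h` is the proof: the index NAMES statements, it never re-types them. -/
abbrev StatementOf {P : Prop} (_h : P) : Prop := P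
end PartXzi
open PartXzi

noncomputable section
universe u₁ u₂ u₃ u₄ u₅ u₆ u₇ u₈ u₉ u₁₀ u₁₁ u₁₂ u₁₃ u₁₄ u₁₅ u₁₆


/-- [node IUTchI:Ex3.2(ii) · L5/D2 · [IUTchI] Ex 3.2 (ii), kurims p.69 · p679494 · claim · DAG status discharged(p679494+p669815+p671230)] decls 1 · DISCHARGE SIBLING of the data node `N_IUTchI_Ex3_2_ii` (which binds the item's typed STATEMENT def): this sibling binds the theorems of the lead-designated proof module(s) — the p-id(s) of the row's own discharged(…) token — whose CONCLUSION HEAD is that statement (farm scan, ProducersScan conclusion-head rule; STANDING RULE DSIB-S (abc-iut-dag g8 2026-08-28T02:18:32Z + erratum 02:18:49Z): the chair's one line = designation + no-strike; filed ≥ 30 min after it under the DSIB-1 guards (a)–(h); designation = abc-iut-L5-lead g16 A-TOKEN via CONE-L5-STATUS.tsv (23:56Z) folded by abc-iut-dag g11 at tick #66 2026-08-29T00:02:09Z: «IUTchI:Ex3.2(i) landed→discharged(p679494+p666763+p667500) · (ii) →discharged(p679494+p669815+p671230) · (iii) →discharged(p679494+p668511+p670709)» (GA-07 knit ★ p679494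 `GenuineFKitOfBadLocalTemperedArith` + the GAP-A modules of record); dischargers = the FACT-minimal conclusion-head theorems INSIDE those modules (farm ProducersScan 00:08Z, fold INDEX-DISCHARGER-CANDIDATES-2.tsv rows of 00:1xZ)); append-only; dag: kernel_id := `N_IUTchI_Ex3_2_ii'` · conjuncts NOT covered (bound statement defs with no discharger in the designated module(s); nothing claimed about them): `orbitClosure`, `mu2l`, `conjMaps`, `thetaOrbit`, `CFromF`, `ThetaFromF`, `FthetaFromF` · dischargers binding assumption-class FACT rows (no assumption-free discharger exists for that def): `biratFromF_frobeniusBadAt_ofArith` F-0240|refuted-closure · designated proof p-ids p679494,p669815,p671230 · the item's OWN statement def(s): `orbitClosure`, `mu2l`, `conjMaps`, `thetaOrbit` · discharger = `InitialThetaData.biratFromF_frobeniusBadAt_ofArith` (★ p679494 GenuineFKitOfBadLocalTemperedArith :239 — [IUTchI] Ex 3.2 (ii) «ℱ÷_v := ℱ̲_v^birat reconstructed category-theoretically» AT THE GENUINE (m1) `badTemperedRestArith`; conclusion head `BadLocalFrobenioid.BiratFromF`; binder census of the scan: F-0240 (refuted-closure FACT row, instance form at the datum)); NOT covered (no conclusion-head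 theorem in the designated modules; nothing claimed): `orbitClosure`, `mu2l`, `conjMaps`, `thetaOrbit`, `CFromF` (→ the (iii) sibling), `ThetaFromF`, `FthetaFromF`; A-token count per chair/director (A OPEN 5→2), typed/discharged-at-our-data ≠ proved-in-print · HONEST FRAMING: dischargers = OUR theorems about OUR typed statement, proved at our data / at a model where the designated module says so; discharged-at-our-data ≠ endorsed ≠ proved-in-print; census of record for the printed item = plan/L5/NODES.md; no side taken on [IUTchIII] Cor 3.12 · decl list as NAMED BY THE AUDITOR/LEAD (forced, not re-resolved) · cites→ IUTchI:Def3.1,IUTchI:Rmk3.2.1,IUTchI:Rmk3.2.2,IUTchI:Rmk3.2.3,IUTchI:Rmk3.2.4 -/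
abbrev N_IUTchI_Ex3_2_ii' : Prop := StatementOf @Literature.IUT.HodgeTheaters.InitialThetaData.biratFromF_frobeniusBadAt_ofArith
/-- discharge of `N_IUTchI_Ex3_2_ii'`: the landed theorems it names, BY NAME (spec §2(c)); proves nothing new. -/
theorem N_IUTchI_Ex3_2_ii'_holds : N_IUTchI_Ex3_2_ii' := @Literature.IUT.HodgeTheaters.InitialThetaData.biratFromF_frobeniusBadAt_ofArith

/-- [node IUTchI:Ex3.2(iii) · L5/D2 · [IUTchI] Ex 3.2 (iii), kurims p.69 · p679494 · claim · DAG status discharged(p679494+p668511+p670709)] decls 1 · DISCHARGE SIBLING of the data node `N_IUTchI_Ex3_2_iii` (which binds the item's typed STATEMENT def): this sibling binds the theorems of the lead-designated proof module(s) — the p-id(s) of the row's own discharged(…) token — whose CONCLUSION HEAD is that statement (farm scan, ProducersScan conclusion-head rule; STANDING RULE DSIB-S (abc-iut-dag g8 2026-08-28T02:18:32Z + erratum 02:18:49Z): the chair's one line = designation + no-strike; filed ≥ 30 min after it under the DSIB-1 guards (a)–(h); designation = abc-iut-L5-lead g16 A-TOKEN via CONE-L5-STATUS.tsv (23:56Z)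 folded by abc-iut-dag g11 at tick #66 2026-08-29T00:02:09Z: «IUTchI:Ex3.2(i) landed→discharged(p679494+p666763+p667500) · (ii) →discharged(p679494+p669815+p671230) · (iii) →discharged(p679494+p668511+p670709)» (GA-07 knit ★ p679494 `GenuineFKitOfBadLocalTemperedArith` + the GAP-A modules of record); dischargers = the FACT-minimal conclusion-head theorems INSIDE those modules (farm ProducersScan 00:08Z, fold INDEX-DISCHARGER-CANDIDATES-2.tsv rows of 00:1xZ)); append-only; dag: kernel_id := `N_IUTchI_Ex3_2_iii'` · conjuncts NOT covered (bound statement defs with no discharger in the designated module(s); nothing claimed about them): `FdashFromC` · dischargers binding assumption-class FACT rows (no assumption-free discharger exists for that def): `cFromF_frobeniusBadAt_ofArith_of_isSlimGroup` F-0240|refuted-closure · designated proof p-ids p679494,p668511,p670709 · the item's OWN statement def(s): `CFromF` · discharger = `InitialThetaData.cFromF_frobeniusBadAt_ofArith_of_isSlimGroup` (★ p679494 :268 — [IUTchI] Ex 3.2 (iii) «𝒞_v ⊆ ℱ̲_v reconstructed» AT THE GENUINE (m1), the (iii) FORM OF RECORD per RULINGS #368 (B)/D20 `(hH : IsClosed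 H) (hZ : IsSlimGroup H)`; conclusion head `BadLocalFrobenioid.CFromF` = FACT F-0676 (refuted-closure) now DISCHARGED AT THE DATUM in instance form; scan binder census: F-0240); NOT covered: `FdashFromC`; other in-module (iii) theorems (`cFromF_frobeniusBadAt_ofArith`, `…_of_isClosed_of_ker_slim`, `…_standIn_of_geom_slim` fa 2) exist — FACT-minimal rule picked the form of record; typed/discharged-at-our-data ≠ proved-in-print · HONEST FRAMING: dischargers = OUR theorems about OUR typed statement, proved at our data / at a model where the designated module says so; discharged-at-our-data ≠ endorsed ≠ proved-in-print; census of record for the printed item = plan/L5/NODES.md; no side taken on [IUTchIII] Cor 3.12 · decl list as NAMED BY THE AUDITOR/LEAD (forced, not re-resolved) · cites→ IUTchI:Def3.1,IUTchI:Rmk3.2.1,IUTchI:Rmk3.2.2,IUTchI:Rmk3.2.3,IUTchI:Rmk3.2.4 -/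
abbrev N_IUTchI_Ex3_2_iii' : Prop := StatementOf @Literature.IUT.HodgeTheaters.InitialThetaData.cFromF_frobeniusBadAt_ofArith_of_isSlimGroup
/-- discharge of `N_IUTchI_Ex3_2_iii'`: the landed theorems it names, BY NAME (spec §2(c)); proves nothing new. -/
theorem N_IUTchI_Ex3_2_iii'_holds : N_IUTchI_Ex3_2_iii' := @Literature.IUT.HodgeTheaters.InitialThetaData.cFromF_frobeniusBadAt_ofArith_of_isSlimGroup

end

end Summit.ABC.IUTFork.DAG
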